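import Summits.QuantumFields.YangMills.Theorems.F4SubCurvatureDoorForwardConeLukacsAlgebra
import Mathlib
import HarnessLib

/-!
# Rung R-S1ℓ `LukacsOneDim` of the S1 programme (LINE g21-B «fibre dichotomy» / forward-cone rungs, crux ⟨stmt-QuantumFields-23125⟩) — PROVED BY NAME

Free-hands rung of width seat `ym-line-sfw-p2-w3` (g37, cell `ym-idea-1`) for OWNER `ym-idea-3` g21's rungs file
`Cruxes/RationalToGeneral/Lines/forward_cone_rungs.lean` (namespace `…Cruxes.RationalToGeneral.ForwardConeRungs`).  The Prop `LukacsOneDim`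
is proved here in unfolded form (`exists_expMoment_of_analyticAt_cosTransform`); the character-identical restatement + the one-line by-name
corollary `lukacsOneDim_holds : LukacsOneDim` live in the companion file `…ForwardConeLukacsOneDimRung.lean` (def-free proof file here):

> a finite positive measure `m` on `ℝ` whose cosine transform `φ(s) = ∫ cos(sq) dm` is real-analytic at `0` has an exponential moment
> `∫ e^{δ|q|} dm < ∞` for some `δ > 0` ([Lukacs 1970, Thm 7.1.1], one-dimensional, even part).

DERIVATIVE-FREE PROOF (no differentiation under the integral, no moment problem).  (i) `AnalyticAt` gives a power series `φ(y) = Σ aₙ yⁿ` on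
`|y| < r` with `|aₙ| ρⁿ ≤ C` for some `0 < ρ < r`.  (ii) By the algebra file (`two_sub_two_cos_pow_eq_sum`),
`∫ (2 − 2cos(hq))^k dm = (−1)^k Σ_{j ≤ 2k} (−1)^j C(2k,j) φ((j − k)h)`.  (iii) Plugging the series in, the `2k`-th symmetric difference kills all
powers below `2k` (`symmDiff_pow_eq_zero`) and the tail is geometric (`abs_symmDiff_pow_le`), whence
`∫ (2 − 2cos(hq))^k dm ≤ 2C (2k/ρ)^{2k} h^{2k}` for `0 < h ≤ ρ/(2k)` (`abs_symmDiff_le_of_hasFPowerSeriesOnBall`).  (iv) Since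
`(2 − 2cos(hq))^k = h^{2k} (q sinc(hq/2))^{2k} → h^{2k} q^{2k}`, Fatou gives `∫ q^{2k} dm ≤ 2C (2k/ρ)^{2k}` (`integrable_pow_of_symmDiff_bound`).
(v) `e^{δ|q|} ≤ 2cosh(δq) = Σ_k 2δ^{2k} q^{2k}/(2k)!` and `(2k)^{2k}/(2k)! ≤ e^{2k}`, so with `δ = ρ/(2e)` Tonelli (`lintegral_tsum`) bounds
`∫ e^{δ|q|} dm` by `Σ_k (2δ^{2k}/(2k)!·m(ℝ) + 4C·4^{−k}) < ∞`.

HONEST LABEL: a classical ONE-DIMENSIONAL lemma (an import of `InitialAperture`/`SpatialExponentialMoments`), nothing more; S1, ⟨23125⟩, ⟨23035⟩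
and R2d stay OPEN; the Yang–Mills mass gap is NOT proved by this file.
-/

set_option autoImplicit false

noncomputable section

namespace Summit.QuantumFields.YangMills.Theorems.F4SubCurvatureDoorForwardConeLukacs

open Finset MeasureTheory Filter
open scoped BigOperators Real Topology ENNReal

/-! ## (iii) Symmetric differences of an analytic function are `O(h^{2k})` with geometric constants -/

/-- If `φ` has the power series `p` on the ball of radius `r` about `0`, `0 < ρ`, `ρ < r` and `‖pₙ‖ ρⁿ ≤ C`, then for `k ≥ 1` and
`0 < h ≤ ρ/(2k)`: `|Σ_{j≤2k} (−1)^j C(2k,j) φ((j − k)h)| ≤ 2C (2k/ρ)^{2k} h^{2k}`. -/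
theorem abs_symmDiff_le_of_hasFPowerSeriesOnBall {φ : ℝ → ℝ} {p : FormalMultilinearSeries ℝ ℝ ℝ} {r : ℝ≥0∞}
    (hφ : HasFPowerSeriesOnBall φ p 0 r) {ρ C : ℝ} (hρ : 0 < ρ) (hρr : ENNReal.ofReal ρ < r)
    (hC : ∀ n, ‖p n‖ * ρ ^ n ≤ C) (k : ℕ) (hk : 1 ≤ k) {h : ℝ} (hh : 0 < h) (hhk : h ≤ ρ / (2 * k)) :
    |∑ j ∈ range (2 * k + 1), (-1 : ℝ) ^ j * ((2 * k).choose j : ℝ) * φ (((j : ℝ) - k) * h)| ≤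
      2 * C * (2 * k / ρ) ^ (2 * k) * h ^ (2 * k) := by
  have hkpos : (0 : ℝ) < k := by exact_mod_cast hk
  have hC0 : 0 ≤ C := by
    have h0 := hC 0
    rw [pow_zero, mul_one] at h0
    exact (norm_nonneg _).trans h0
  -- the coefficients `aₙ`
  set a : ℕ → ℝ := fun n => p.coeff n with ha_def
  have ha : ∀ n, |a n| ≤ C / ρ ^ n := fun n => by
    rw [le_div_iff₀ (pow_pos hρ n), ha_def]
    simpa [FormalMultilinearSeries.norm_apply_eq_norm_coef, Real.norm_eq_abs] using hC n
  -- the ratio `t = kh/ρ ≤ 1/2`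
  set t : ℝ := k * h / ρ with ht_def
  have ht0 : 0 ≤ t := by positivity
  have ht : t ≤ 1 / 2 := by
    rw [ht_def, div_le_iff₀ hρ]
    have := (le_div_iff₀ (by positivity : (0 : ℝ) < 2 * k)).1 hhk
    linarith
  have ht1 : t < 1 := by linarith
  -- expansion of each `φ((j − k)h)`
  have hexp : ∀ j ∈ range (2 * k + 1),
      HasSum (fun n => a n * (((j : ℝ) - k) * h) ^ n) (φ (((j : ℝ) - k) * h)) := by
    intro j hj
    have hjle : (j : ℝ) ≤ 2 * k := by exact_mod_cast Nat.lt_succ_iff.1 (mem_range.1 hj)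
    have habs : |((j : ℝ) - k) * h| ≤ ρ / 2 := by
      rw [abs_mul, abs_of_pos hh]
      have h1 : |(j : ℝ) - k| ≤ k := by rw [abs_le]; constructor <;> linarith [(Nat.cast_nonneg j : (0 : ℝ) ≤ j)]
      calc |(j : ℝ) - k| * h ≤ k * h := mul_le_mul_of_nonneg_right h1 hh.le
        _ ≤ k * (ρ / (2 * k)) := mul_le_mul_of_nonneg_left hhk hkpos.le
        _ = ρ / 2 := by field_simp
    have hy : (((j : ℝ) - k) * h) ∈ Metric.eball (0 : ℝ) r := by
      rw [Metric.mem_eball, edist_zero_right, ← ofReal_norm, Real.norm_eq_abs]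
      exact lt_of_le_of_lt (ENNReal.ofReal_le_ofReal (by linarith)) hρr
    have hs := hφ.hasSum hy
    rw [zero_add] at hs
    refine hs.congr_fun fun n => ?_
    rw [FormalMultilinearSeries.apply_eq_pow_smul_coeff, smul_eq_mul, mul_comm]
  -- the summed expansion, regrouped by powers of `h`
  set S : ℕ → ℝ := fun n => ∑ j ∈ range (2 * k + 1), (-1 : ℝ) ^ j * ((2 * k).choose j : ℝ) * ((j : ℝ) - k) ^ n
    with hS_def
  set T : ℕ → ℝ := fun n => a n * h ^ n * S n with hT_def
  have hT : HasSum T (∑ j ∈ range (2 * k + 1), (-1 : ℝ) ^ j * ((2 * k).choose j : ℝ) * φ (((j : ℝ) - k) * h)) := by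
    have h1 := hasSum_sum fun j hj => (hexp j hj).mul_left ((-1 : ℝ) ^ j * ((2 * k).choose j : ℝ))
    refine h1.congr_fun fun n => ?_
    simp only [hT_def, hS_def, Finset.mul_sum]
    refine Finset.sum_congr rfl fun j _ => ?_
    rw [mul_pow]; ring
  -- the first `2k` terms vanish
  have hT0 : ∀ n, n < 2 * k → T n = 0 := fun n hn => by
    simp only [hT_def, hS_def, symmDiff_pow_eq_zero k n hn, mul_zero]
  have hshift : HasSum (fun n => T (n + 2 * k))
      (∑ j ∈ range (2 * k + 1), (-1 : ℝ) ^ j * ((2 * k).choose j : ℝ) * φ (((j : ℝ) - k) * h)) := by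
    have := (hasSum_nat_add_iff' (f := T) (2 * k)).2 hT
    rwa [Finset.sum_eq_zero (fun i hi => hT0 i (mem_range.1 hi)), sub_zero] at this
  -- termwise geometric bound
  have hTle : ∀ n, ‖T (n + 2 * k)‖ ≤ C * 4 ^ k * t ^ (2 * k) * t ^ n := by
    intro n
    rw [Real.norm_eq_abs, hT_def]
    simp only
    rw [abs_mul, abs_mul, abs_pow, abs_of_pos hh]
    have h1 := ha (n + 2 * k)
    have h2 := abs_symmDiff_pow_le k (n + 2 * k)
    calc |a (n + 2 * k)| * h ^ (n + 2 * k) * |S (n + 2 * k)|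
        ≤ (C / ρ ^ (n + 2 * k)) * h ^ (n + 2 * k) * ((4 : ℝ) ^ k * (k : ℝ) ^ (n + 2 * k)) := by
          gcongr
      _ = C * 4 ^ k * t ^ (2 * k) * t ^ n := by
          rw [ht_def]
          simp only [div_pow, mul_pow]
          ring
  have hgeom : HasSum (fun n => C * 4 ^ k * t ^ (2 * k) * t ^ n) (C * 4 ^ k * t ^ (2 * k) * (1 - t)⁻¹) :=
    (hasSum_geometric_of_lt_one ht0 ht1).mul_left _
  have hbound := tsum_of_norm_bounded hgeom hTle
  rw [← hshift.tsum_eq]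
  refine (Real.norm_eq_abs _ ▸ hbound).trans ?_
  have hinv : (1 - t)⁻¹ ≤ 2 := by
    rw [inv_le_comm₀ (by linarith) (by norm_num)]; linarith
  have hK : 0 ≤ C * 4 ^ k * t ^ (2 * k) := by positivity
  calc C * 4 ^ k * t ^ (2 * k) * (1 - t)⁻¹ ≤ C * 4 ^ k * t ^ (2 * k) * 2 :=
        mul_le_mul_of_nonneg_left hinv hK
    _ = 2 * C * (2 * k / ρ) ^ (2 * k) * h ^ (2 * k) := by
        rw [ht_def, show (4 : ℝ) ^ k = 2 ^ (2 * k) by rw [pow_mul]; norm_num]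
        simp only [div_pow, mul_pow]
        ring

/-! ## (iv) Fatou: moments from symmetric differences -/

/-- `h · (q sinc(hq/2)) = 2 sin(hq/2)`. -/
theorem mul_mul_sinc (h q : ℝ) : h * (q * Real.sinc (h * q / 2)) = 2 * Real.sin (h * q / 2) := by
  by_cases hx : h * q / 2 = 0
  · have h0 : h * q = 0 := by linarith
    rw [hx, Real.sinc_zero, Real.sin_zero, mul_one, mul_zero, h0]
  · rw [Real.sinc_of_ne_zero hx]
    have h1 : h * (q * (Real.sin (h * q / 2) / (h * q / 2))) = (h * q / 2)⁻¹ * (h * q / 2) * (2 * Real.sin (h * q / 2)) := by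
      ring
    rw [h1, inv_mul_cancel₀ hx, one_mul]

/-- `(2 − 2cos(hq))^k = h^{2k} (q sinc(hq/2))^{2k}`. -/
theorem two_sub_two_cos_pow_eq_sinc (h q : ℝ) (k : ℕ) :
    (2 - 2 * Real.cos (h * q)) ^ k = h ^ (2 * k) * (q * Real.sinc (h * q / 2)) ^ (2 * k) := by
  have h1 : 2 - 2 * Real.cos (h * q) = (2 * Real.sin (h * q / 2)) ^ 2 := by
    rw [mul_pow, Real.sin_sq_eq_half_sub, show 2 * (h * q / 2) = h * q by ring]; ring
  rw [h1, ← mul_pow, mul_mul_sinc, ← pow_mul]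

/-- `|q sinc(hq/2)| ≤ 2/h` for `h > 0`. -/
theorem abs_mul_sinc_le {h : ℝ} (hh : 0 < h) (q : ℝ) : |q * Real.sinc (h * q / 2)| ≤ 2 / h := by
  have h1 : |h * (q * Real.sinc (h * q / 2))| ≤ 2 := by
    rw [mul_mul_sinc, abs_mul, abs_two]
    have := Real.abs_sin_le_one (h * q / 2)
    linarith
  rw [abs_mul, abs_of_pos hh] at h1
  rw [le_div_iff₀ hh]
  calc |q * Real.sinc (h * q / 2)| * h = h * |q * Real.sinc (h * q / 2)| := mul_comm _ _
    _ ≤ 2 := h1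

/-- **Fatou step.**  If `∫ (2 − 2cos(hq))^k dm ≤ B h^{2k}` for all `0 < h < h₀`, then `q ↦ q^{2k}` is `m`-integrable and
`∫ q^{2k} dm ≤ B`. -/
theorem integrable_pow_of_symmDiff_bound (m : Measure ℝ) [IsFiniteMeasure m] (k : ℕ) {B h₀ : ℝ} (hh₀ : 0 < h₀)
    (hB : ∀ h : ℝ, 0 < h → h < h₀ → ∫ q, (2 - 2 * Real.cos (h * q)) ^ k ∂m ≤ B * h ^ (2 * k)) :
    Integrable (fun q : ℝ => q ^ (2 * k)) m ∧ ∫ q, q ^ (2 * k) ∂m ≤ B := by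
  -- the sequence `hₙ = h₀/(n+2)`
  set hs : ℕ → ℝ := fun n => h₀ / ((n : ℝ) + 2) with hs_def
  have hs_pos : ∀ n, 0 < hs n := fun n => div_pos hh₀ (by positivity)
  have hs_lt : ∀ n, hs n < h₀ := fun n => by
    rw [hs_def]
    exact div_lt_self hh₀ (by linarith [(Nat.cast_nonneg n : (0 : ℝ) ≤ n)])
  have hs_tendsto : Tendsto hs atTop (𝓝 0) := by
    have h1 := (tendsto_add_atTop_iff_nat 2).2 (tendsto_const_div_atTop_nhds_zero_nat h₀)
    refine h1.congr fun n => ?_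
    simp [hs_def, Nat.cast_add]
  -- the regularised integrands `gₙ(q) = (q sinc(hₙq/2))^{2k}`
  set g : ℕ → ℝ → ℝ := fun n q => (q * Real.sinc (hs n * q / 2)) ^ (2 * k) with hg_def
  have hg_nonneg : ∀ n q, 0 ≤ g n q := fun n q => (even_two_mul k).pow_nonneg _
  have hg_cont : ∀ n, Continuous (g n) := fun n => by
    simp only [hg_def]
    exact ((continuous_id.mul (Real.continuous_sinc.comp ((continuous_const.mul continuous_id).div_const _))).pow _)
  have hg_int : ∀ n, Integrable (g n) m := fun n => by
    refine Integrable.of_bound (hg_cont n).aestronglyMeasurable ((2 / hs n) ^ (2 * k)) (ae_of_all _ fun q => ?_)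
    rw [Real.norm_eq_abs, hg_def]
    simp only
    rw [abs_pow]
    exact pow_le_pow_left₀ (abs_nonneg _) (abs_mul_sinc_le (hs_pos n) q) _
  have hg_le : ∀ n, ∫ q, g n q ∂m ≤ B := fun n => by
    have h1 := hB (hs n) (hs_pos n) (hs_lt n)
    have h2 : (fun q => (2 - 2 * Real.cos (hs n * q)) ^ k) = fun q => hs n ^ (2 * k) * g n q := by
      funext q; rw [two_sub_two_cos_pow_eq_sinc]
    rw [h2, integral_const_mul, mul_comm B] at h1
    exact le_of_mul_le_mul_left h1 (pow_pos (hs_pos n) _)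
  have hB0 : 0 ≤ B := (integral_nonneg (hg_nonneg 0)).trans (hg_le 0)
  -- pointwise convergence `gₙ(q) → q^{2k}`
  have hlim : ∀ q, Tendsto (fun n => g n q) atTop (𝓝 (q ^ (2 * k))) := fun q => by
    have h1 : Tendsto (fun n => hs n * q / 2) atTop (𝓝 0) := by
      simpa using (hs_tendsto.mul_const q).div_const 2
    have h2 : Tendsto (fun n => Real.sinc (hs n * q / 2)) atTop (𝓝 1) := by
      rw [← Real.sinc_zero]
      exact (Real.continuous_sinc.tendsto 0).comp h1
    simpa [hg_def] using ((tendsto_const_nhds (x := q)).mul h2).pow (2 * k)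
  -- Fatou
  have hnn : 0 ≤ᵐ[m] fun q : ℝ => q ^ (2 * k) := ae_of_all _ fun q => (even_two_mul k).pow_nonneg q
  have hmeas : AEStronglyMeasurable (fun q : ℝ => q ^ (2 * k)) m := (continuous_pow (2 * k)).aestronglyMeasurable
  have hF : ∫⁻ q, ENNReal.ofReal (q ^ (2 * k)) ∂m ≤ ENNReal.ofReal B := by
    have hmeas' : ∀ n, AEMeasurable (fun q => ENNReal.ofReal (g n q)) m :=
      fun n => (hg_int n).aestronglyMeasurable.aemeasurable.ennreal_ofReal
    have hfatou := lintegral_liminf_le' (u := atTop) hmeas'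
    have hl : (fun q => liminf (fun n => ENNReal.ofReal (g n q)) atTop) = fun q => ENNReal.ofReal (q ^ (2 * k)) := by
      funext q
      exact ((ENNReal.continuous_ofReal.tendsto _).comp (hlim q)).liminf_eq
    rw [hl] at hfatou
    refine hfatou.trans (liminf_le_of_frequently_le' (Eventually.of_forall fun n => ?_).frequently)
    rw [← ofReal_integral_eq_lintegral_ofReal (hg_int n) (ae_of_all _ (hg_nonneg n))]
    exact ENNReal.ofReal_le_ofReal (hg_le n)
  have hint : Integrable (fun q : ℝ => q ^ (2 * k)) m :=
    ⟨hmeas, (hasFiniteIntegral_iff_ofReal hnn).2 (hF.trans_lt ENNReal.ofReal_lt_top)⟩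
  refine ⟨hint, ?_⟩
  rw [integral_eq_lintegral_of_nonneg_ae hnn hmeas]
  exact ENNReal.toReal_le_of_le_ofReal hB0 hF

/-! ## Lukacs' theorem (one-dimensional, even part) -/

/-- `(n)^n/n! ≤ e^n`, in the form `(n c)^n / n! ≤ (c e)^n` for `c ≥ 0`. -/
theorem mul_pow_div_factorial_le (n : ℕ) {c : ℝ} (hc : 0 ≤ c) :
    ((n : ℝ) * c) ^ n / (n.factorial : ℝ) ≤ (c * Real.exp 1) ^ n := by
  have h1 := Real.pow_div_factorial_le_exp (n : ℝ) (Nat.cast_nonneg n) n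
  rw [← Real.exp_one_pow] at h1
  rw [mul_pow, mul_comm ((n : ℝ) ^ n), mul_div_assoc, mul_pow]
  exact mul_le_mul_of_nonneg_left h1 (pow_nonneg hc _)

/-- **LUKACS (1-D)** — the statement of rung R-S1ℓ `ForwardConeRungs.LukacsOneDim`, unfolded: a finite positive measure on `ℝ` whose cosine
transform is real-analytic at `0` has an exponential moment.  (The by-name rung `lukacsOneDim_holds : LukacsOneDim` is the one-line corollary in
the companion file `…ForwardConeLukacsOneDimRung.lean`.) -/
theorem exists_expMoment_of_analyticAt_cosTransform (m : Measure ℝ) [IsFiniteMeasure m] (φ : ℝ → ℝ)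
    (hφ : ∀ s : ℝ, φ s = ∫ q, Real.cos (s * q) ∂m) (hA : AnalyticAt ℝ φ 0) :
    ∃ δ : ℝ, 0 < δ ∧ Integrable (fun q : ℝ => Real.exp (δ * |q|)) m := by
  -- (i) power-series data at `0`
  rcases hA with ⟨p, r, hr⟩
  obtain ⟨ρ, -, hρpos, hρr⟩ := ENNReal.lt_iff_exists_real_btwn.1 hr.r_pos
  have hρ : 0 < ρ := by simpa using hρpos
  obtain ⟨C, -, hC⟩ := p.norm_mul_pow_le_of_lt_radius (r := ρ.toNNReal) (lt_of_lt_of_le hρr hr.r_le)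
  have hC' : ∀ n, ‖p n‖ * ρ ^ n ≤ C := fun n => by
    have := hC n; rwa [Real.coe_toNNReal _ hρ.le] at this
  have hC0 : 0 ≤ C := by
    have h0 := hC' 0
    rw [pow_zero, mul_one] at h0
    exact (norm_nonneg _).trans h0
  -- (ii) the symmetric differences of `φ` are the trigonometric moments
  have hcos_int : ∀ s : ℝ, Integrable (fun q : ℝ => Real.cos (s * q)) m := fun s =>
    Integrable.of_bound (Continuous.aestronglyMeasurable (by fun_prop)) 1
      (ae_of_all _ fun q => by simpa using Real.abs_cos_le_one (s * q))
  have hInt : ∀ (k : ℕ) (h : ℝ), ∫ q, (2 - 2 * Real.cos (h * q)) ^ k ∂m =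
      (-1) ^ k * ∑ j ∈ range (2 * k + 1), (-1 : ℝ) ^ j * ((2 * k).choose j : ℝ) * φ (((j : ℝ) - k) * h) := by
    intro k h
    have h1 : (fun q : ℝ => (2 - 2 * Real.cos (h * q)) ^ k) = fun q =>
        (-1) ^ k * ∑ j ∈ range (2 * k + 1), (-1 : ℝ) ^ j * ((2 * k).choose j : ℝ) * Real.cos ((((j : ℝ) - k) * h) * q) := by
      funext q
      rw [two_sub_two_cos_pow_eq_sum]
      congr 1
      refine Finset.sum_congr rfl fun j _ => ?_
      rw [mul_assoc ((j : ℝ) - k) h q]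
    rw [h1, integral_const_mul, integral_finsetSum _ fun j _ => (hcos_int _).const_mul _]
    congr 1
    refine Finset.sum_congr rfl fun j _ => ?_
    rw [integral_const_mul, hφ]
  -- (iii) `∫ (2 − 2cos(hq))^k dm ≤ 2C(2k/ρ)^{2k} h^{2k}` for `0 < h < ρ/(2k)`, `k ≥ 1`
  have hB : ∀ k : ℕ, 1 ≤ k → ∀ h : ℝ, 0 < h → h < ρ / (2 * k) →
      ∫ q, (2 - 2 * Real.cos (h * q)) ^ k ∂m ≤ (2 * C * (2 * k / ρ) ^ (2 * k)) * h ^ (2 * k) := by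
    intro k hk h hh hhk
    rw [hInt]
    have h1 := abs_symmDiff_le_of_hasFPowerSeriesOnBall hr hρ hρr hC' k hk hh hhk.le
    refine le_trans ?_ h1
    refine (le_abs_self _).trans (le_of_eq ?_)
    rw [abs_mul, abs_pow, abs_neg, abs_one, one_pow, one_mul]
  -- (iv) even moments
  set M0 : ℝ := ∫ _q : ℝ, (1 : ℝ) ∂m with hM0_def
  have hM0 : 0 ≤ M0 := integral_nonneg fun _ => zero_le_one
  have hMom : ∀ k : ℕ, Integrable (fun q : ℝ => q ^ (2 * k)) m ∧
      ∫ q, q ^ (2 * k) ∂m ≤ M0 + 2 * C * (2 * k / ρ) ^ (2 * k) := by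
    intro k
    rcases Nat.eq_zero_or_pos k with rfl | hk
    · simp only [mul_zero, pow_zero, Nat.cast_zero, zero_div]
      exact ⟨integrable_const _, by rw [hM0_def]; linarith⟩
    · have h1 := integrable_pow_of_symmDiff_bound m k (B := 2 * C * (2 * k / ρ) ^ (2 * k)) (h₀ := ρ / (2 * k))
        (by positivity) (hB k hk)
      exact ⟨h1.1, h1.2.trans (by linarith)⟩
  -- (v) the exponential moment with `δ = ρ/(2e)`
  set δ : ℝ := ρ / (2 * Real.exp 1) with hδ_def
  have hδ : 0 < δ := by positivity
  have hδe : δ * Real.exp 1 = ρ / 2 := by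
    rw [hδ_def, div_mul_eq_mul_div, mul_comm (2 : ℝ) (Real.exp 1), ← div_div, mul_div_assoc,
      div_self (Real.exp_pos 1).ne', mul_one]
  refine ⟨δ, hδ, ?_⟩
  -- the majorant coefficients `c k = (2δ^{2k}/(2k)!) (M0 + 2C(2k/ρ)^{2k})`
  set c : ℕ → ℝ := fun k => (2 * δ ^ (2 * k) / ((2 * k).factorial : ℝ)) * (M0 + 2 * C * (2 * k / ρ) ^ (2 * k))
    with hc_def
  have hc_nonneg : ∀ k, 0 ≤ c k := fun k => by positivity
  -- `c k ≤ 2 M0 δ^{2k}/(2k)! + 4C (1/4)^k`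
  have hc_le : ∀ k, c k ≤ M0 * (2 * (δ ^ (2 * k) / ((2 * k).factorial : ℝ))) + 4 * C * (1 / 4 : ℝ) ^ k := by
    intro k
    have h1 : (2 * δ ^ (2 * k) / ((2 * k).factorial : ℝ)) * (2 * C * (2 * k / ρ) ^ (2 * k)) ≤ 4 * C * (1 / 4 : ℝ) ^ k := by
      have h2 := mul_pow_div_factorial_le (2 * k) (c := δ / ρ) (by positivity)
      have h3 : (δ / ρ * Real.exp 1) ^ (2 * k) = (1 / 4 : ℝ) ^ k := by
        have h5 : δ / ρ * Real.exp 1 = 1 / 2 := by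
          rw [div_mul_eq_mul_div, hδe, div_div, div_eq_div_iff (by positivity) (by norm_num)]
          ring
        rw [h5, pow_mul]
        norm_num
      have h4 : (2 * δ ^ (2 * k) / ((2 * k).factorial : ℝ)) * (2 * C * (2 * k / ρ) ^ (2 * k)) =
          4 * C * ((((2 * k : ℕ) : ℝ) * (δ / ρ)) ^ (2 * k) / ((2 * k).factorial : ℝ)) := by
        push_cast
        ring
      rw [h4, ← h3]
      exact mul_le_mul_of_nonneg_left h2 (by positivity)
    calc c k = (2 * δ ^ (2 * k) / ((2 * k).factorial : ℝ)) * M0 +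
          (2 * δ ^ (2 * k) / ((2 * k).factorial : ℝ)) * (2 * C * (2 * k / ρ) ^ (2 * k)) := by rw [hc_def]; ring
      _ ≤ M0 * (2 * (δ ^ (2 * k) / ((2 * k).factorial : ℝ))) + 4 * C * (1 / 4 : ℝ) ^ k := by
          refine add_le_add (le_of_eq (by ring)) h1
  have hc_summable : Summable c := by
    refine Summable.of_nonneg_of_le hc_nonneg hc_le (Summable.add ?_ ?_)
    · exact ((Real.hasSum_cosh δ).summable.mul_left 2).mul_left M0
    · exact (summable_geometric_of_lt_one (by norm_num) (by norm_num)).mul_left _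
  -- pointwise: `e^{δ|q|} ≤ Σ_k (2δ^{2k}/(2k)!) q^{2k}`
  have hpt : ∀ q : ℝ, ENNReal.ofReal (Real.exp (δ * |q|)) ≤
      ∑' k : ℕ, ENNReal.ofReal ((2 * δ ^ (2 * k) / ((2 * k).factorial : ℝ)) * q ^ (2 * k)) := by
    intro q
    have hcosh : HasSum (fun k : ℕ => (2 * δ ^ (2 * k) / ((2 * k).factorial : ℝ)) * q ^ (2 * k)) (2 * Real.cosh (δ * q)) := by
      refine ((Real.hasSum_cosh (δ * q)).mul_left 2).congr_fun fun k => ?_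
      rw [mul_pow]; ring
    have hnn' : ∀ k : ℕ, 0 ≤ (2 * δ ^ (2 * k) / ((2 * k).factorial : ℝ)) * q ^ (2 * k) :=
      fun k => mul_nonneg (by positivity) ((even_two_mul k).pow_nonneg q)
    rw [← ENNReal.ofReal_tsum_of_nonneg hnn' hcosh.summable, hcosh.tsum_eq]
    refine ENNReal.ofReal_le_ofReal ?_
    have h1 : Real.cosh (δ * q) = Real.cosh (δ * |q|) := by
      rw [← Real.cosh_abs (δ * q), abs_mul, abs_of_pos hδ]
    rw [h1, Real.cosh_eq]
    have := Real.exp_pos (-(δ * |q|))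
    linarith
  -- Tonelli on the majorant
  have hterm_int : ∀ k : ℕ, Integrable (fun q : ℝ => (2 * δ ^ (2 * k) / ((2 * k).factorial : ℝ)) * q ^ (2 * k)) m :=
    fun k => (hMom k).1.const_mul _
  have hterm_meas : ∀ k : ℕ, AEMeasurable
      (fun q : ℝ => ENNReal.ofReal ((2 * δ ^ (2 * k) / ((2 * k).factorial : ℝ)) * q ^ (2 * k))) m :=
    fun k => (hterm_int k).aestronglyMeasurable.aemeasurable.ennreal_ofReal
  have hlin : ∫⁻ q, ENNReal.ofReal (Real.exp (δ * |q|)) ∂m ≤ ENNReal.ofReal (∑' k, c k) := by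
    refine (lintegral_mono fun q => hpt q).trans ?_
    rw [lintegral_tsum hterm_meas, ENNReal.ofReal_tsum_of_nonneg hc_nonneg hc_summable]
    refine ENNReal.tsum_le_tsum fun k => ?_
    rw [← ofReal_integral_eq_lintegral_ofReal (hterm_int k)
      (ae_of_all _ fun q => mul_nonneg (by positivity) ((even_two_mul k).pow_nonneg q)), integral_const_mul]
    refine ENNReal.ofReal_le_ofReal ?_
    rw [hc_def]
    exact mul_le_mul_of_nonneg_left (hMom k).2 (by positivity)
  have hmeas_exp : AEStronglyMeasurable (fun q : ℝ => Real.exp (δ * |q|)) m :=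
    Continuous.aestronglyMeasurable (by fun_prop)
  exact ⟨hmeas_exp, (hasFiniteIntegral_iff_ofReal (ae_of_all _ fun q => (Real.exp_pos _).le)).2
    (hlin.trans_lt ENNReal.ofReal_lt_top)⟩

end Summit.QuantumFields.YangMills.Theorems.F4SubCurvatureDoorForwardConeLukacs

end
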